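import Summits.QuantumFields.YangMills.Theorems.SwapVirialDeficitBlowUpGnomonicStratumBSeamJoint
import Summits.QuantumFields.YangMills.Theorems.SwapVirialDeficitBlowUpGnomonicStratumBSeamCoords
import HarnessLib

/-!
# THE JOINT B-SEAM FLOOR IN COORDINATES: `[(|u|²(z₀′ + 2δ/‖a‖) − ζ)² + |u|²(2x₀′ + z₀′ + ζ)²]/(225·L⁶·(1+|u|²)²) ≤ (d²/ds²)F̂(a − (sδ)·1, ε, η_B + s·ξ_B(d))|₀`
# (free-hands support of ⟨stmt-QuantumFields-24197⟩ `SwapVirialDeficit.SwapGluedStiffness`; stub (S-B) — the `x₀′`-square of ✓`fibre_raySecond_ge_stratumB_seam_coords` is UNCHANGED along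
# joint rays, the hub speed `δ` only enters the other square: no `δ–x₀′` coupling in the joint B-form)

At the end hub `A₀ = ν(axisPoint a) = i` exactly (`re A₀ = 0`, `imI A₀ = ‖im a‖/‖a‖ = 1`) and `A′ = −(δ/‖a‖)·1` is real, so the two extra terms of `W′` in
✓`fibre_raySecond_ge_stratumB_seam_joint` are `A′·(x̂_B A₀ + Ā₀ x̂_B) = A′·[x̂_B, A₀]`, contributing `[x̂_B, A′[x̂_B, i]] = (4δ|u|²/(‖a‖(1+|u|²)))·i` to `f′(0)`:
* `end_hub_eq` (`re A₀ = 0 ∧ imI A₀ = 1 ∧ imJ A₀ = 0 ∧ imK A₀ = 0`);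
* ★★★ `fibre_raySecond_ge_stratumB_seam_joint_coords (ha : a.im ≠ 0) (hre : a.re = 0) (ε) (hz) (hε) (u₁ u₂ δ d)`.

HONEST LABEL: quaternion component algebra on a landed floor; stubs of ➎, ⟨24197⟩ ∕ ⟨24194⟩ ∕ ⟨24497⟩ OPEN; own crux ⟨22884⟩ OPEN (blocked-on ⟨19935⟩); the Yang–Mills mass gap is
NOT proved; no summit is proved by a line.  THEOREMS ONLY (0 `def`, 0 `sorry`), standard axioms.  Width seat ym-line-sfw-p2-w3 g66 (cell ym-idea-1, free hands),
`--supports stmt-QuantumFields-24197`.  References: [cite: Luscher1983, §2]; [folklore].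
-/

set_option autoImplicit false

noncomputable section

open MeasureTheory Quaternion
open scoped BigOperators Quaternion
open Literature.MathematicalPhysics.QuantumFieldTheory hiding SU2
open Literature.MathematicalPhysics.QuantumLattice
open Literature.Analysis.Calculus (radialUnit radialUnit_def norm_radialUnit)

namespace Summit.QuantumFields.YangMills.Theorems.SwapVirialDeficit.BlowUpRing

open Summit.QuantumFields.YangMills.Theorems.FemtoTransferGap
open Summit.QuantumFields.YangMills.Theorems.SwapTwistDeficit.ToronLog (axisPoint)

variable {L : ℕ} [NeZero L]

omit [NeZero L] in
/-- At an end hub the hub unit IS `i`: `re A₀ = 0`, `imI A₀ = 1`, `imJ A₀ = imK A₀ = 0`. [folklore] -/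
theorem end_hub_eq {a : ℍ} (ha : a ≠ 0) (hre : a.re = 0) :
    (radialUnit (axisPoint a)).re = 0 ∧ (radialUnit (axisPoint a)).imI = 1 ∧ (radialUnit (axisPoint a)).imJ = 0 ∧ (radialUnit (axisPoint a)).imK = 0 := by
  obtain ⟨h0, hJ, hK, hI2⟩ := end_hub_components ha hre
  obtain ⟨-, hI, -, -⟩ := axisUnit_components a
  have hnn : 0 ≤ (radialUnit (axisPoint a)).imI := by rw [hI]; positivity
  refine ⟨h0, ?_, hJ, hK⟩
  nlinarith [hI2, hnn]

set_option maxHeartbeats 1600000 in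
/-- ★★★ **THE JOINT B-SEAM FLOOR IN COORDINATES** (end hub `im a ≠ 0`, `re a = 0`; `ε_z = +`, followers `+`; `ζ = u₂z₁′ − u₁z₂′`). [cite: Luscher1983, §2] -/
theorem fibre_raySecond_ge_stratumB_seam_joint_coords {a : ℍ} (ha : a.im ≠ 0) (hre : a.re = 0) (ε : GnoSign L) (hz : ε.2.1 = true) (hε : ε.2.2 = fun _ => true)
    (u₁ u₂ δ : ℝ) (d : ℝ × (Fin 3 → ℝ) × (Fin 3 → ℝ) × (Fol L → Fin 3 → ℝ)) :
    (((u₁ ^ 2 + u₂ ^ 2) * (d.2.2.1 0 + 2 * δ / ‖a‖) - (u₂ * d.2.2.1 1 - u₁ * d.2.2.1 2)) ^ 2 +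
        (u₁ ^ 2 + u₂ ^ 2) * (2 * d.1 + d.2.2.1 0 + (u₂ * d.2.2.1 1 - u₁ * d.2.2.1 2)) ^ 2) / (225 * (L : ℝ) ^ 6 * (1 + (u₁ ^ 2 + u₂ ^ 2)) ^ 2) ≤
      iteratedDeriv 2 (fun s : ℝ => gnoDeficit (fun _ => false) (fun _ => 1) (a - (s * δ) • (1 : ℍ)) ε
        (((((![0, u₁, u₂] : Fin 3 → ℝ), (0 : Fin 3 → ℝ)), ((0 : Fin 3 → ℝ), (0 : Fol L → Fin 3 → ℝ))) : GnoCoord L) +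
          s • ((((![d.1, 0, 0] : Fin 3 → ℝ), d.2.1), (d.2.2.1, d.2.2.2)) : GnoCoord L))) 0 := by
  have hL : (0 : ℝ) < L := by exact_mod_cast NeZero.pos L
  have ha0 : a ≠ 0 := by intro h; apply ha; rw [h]; rfl
  have han : 0 < ‖a‖ := norm_pos_iff.2 ha0
  have h := fibre_raySecond_ge_stratumB_seam_joint (L := L) ha hre ε hz hε u₁ u₂ δ d
  refine le_trans (le_of_eq ?_) h
  -- names
  obtain ⟨A, hA⟩ : ∃ A : ℍ, A = radialUnit (axisPoint a) := ⟨_, rfl⟩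
  obtain ⟨N, hN⟩ : ∃ N : ℝ, N = Real.sqrt (1 + (u₁ ^ 2 + u₂ ^ 2)) := ⟨_, rfl⟩
  obtain ⟨σ, hσ⟩ : ∃ σ : ℝ, σ = gnoSign ε.1.1 := ⟨_, rfl⟩
  obtain ⟨xh, hxh⟩ : ∃ q : ℍ, q = radialUnit (gnoLetter ε.1.1 ![0, u₁, u₂]) := ⟨_, rfl⟩
  obtain ⟨X', hX'⟩ : ∃ q : ℍ, q = N⁻¹ • (σ • (gnomonicQuat ![d.1, 0, 0]).im) := ⟨_, rfl⟩
  obtain ⟨Z', hZ'⟩ : ∃ q : ℍ, q = (gnomonicQuat d.2.2.1).im := ⟨_, rfl⟩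
  obtain ⟨A', hA'⟩ : ∃ q : ℍ, q = -(δ / ‖a‖) • (1 : ℍ) := ⟨_, rfl⟩
  rw [← hA, ← hN, ← hσ, ← hxh, ← hZ', ← hA']
  rw [← hX']
  -- components
  obtain ⟨hAre, hAimI, hAimJ, hAimK⟩ := end_hub_eq ha0 hre
  rw [← hA] at hAre hAimI hAimJ hAimK
  obtain ⟨hxre, hximI, hximJ, hximK⟩ := radialUnit_gnoLetter_transverse_components ε.1.1 u₁ u₂
  rw [← hxh, ← hN, ← hσ] at hxre hximJ hximK
  rw [← hxh] at hximI
  obtain ⟨hPre, hPimI, hPimJ, hPimK⟩ := gnomonicQuat_im_components (![d.1, 0, 0] : Fin 3 → ℝ)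
  obtain ⟨hZre, hZimI, hZimJ, hZimK⟩ := gnomonicQuat_im_components (d.2.2.1)
  rw [← hZ'] at hZre hZimI hZimJ hZimK
  have hX're : X'.re = 0 := by rw [hX', Quaternion.re_smul, Quaternion.re_smul, hPre]; simp
  have hX'imI : X'.imI = N⁻¹ * (σ * d.1) := by
    rw [hX', Quaternion.imI_smul, Quaternion.imI_smul, hPimI]; simp [smul_eq_mul]
  have hX'imJ : X'.imJ = 0 := by rw [hX', Quaternion.imJ_smul, Quaternion.imJ_smul, hPimJ]; simp
  have hX'imK : X'.imK = 0 := by rw [hX', Quaternion.imK_smul, Quaternion.imK_smul, hPimK]; simp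
  have hA're : A'.re = -(δ / ‖a‖) := by rw [hA']; simp
  have hA'imI : A'.imI = 0 := by rw [hA']; simp
  have hA'imJ : A'.imJ = 0 := by rw [hA']; simp
  have hA'imK : A'.imK = 0 := by rw [hA']; simp
  have hsAre : (star A).re = 0 := by rw [Quaternion.re_star, hAre]
  have hsAimI : (star A).imI = -1 := by rw [Quaternion.imI_star, hAimI]
  have hsAimJ : (star A).imJ = 0 := by rw [Quaternion.imJ_star, hAimJ, neg_zero]
  have hsAimK : (star A).imK = 0 := by rw [Quaternion.imK_star, hAimK, neg_zero]
  -- the commutator sum `g` through its four components (brute force over the atoms)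
  obtain ⟨g, hg⟩ : ∃ q : ℍ, q = X' * (star A * xh * A) +
      xh * (A' * xh * A + star A * X' * A + star A * xh * A' + star A * xh * A * Z') -
      ((A' * xh * A + star A * X' * A + star A * xh * A' + star A * xh * A * Z') * xh + star A * xh * A * X') := ⟨_, rfl⟩
  rw [← hg]
  have hgre : g.re = 0 := by
    rw [hg]
    simp only [Quaternion.re_sub, Quaternion.re_add, Quaternion.re_mul, Quaternion.imI_mul, Quaternion.imJ_mul, Quaternion.imK_mul,
      Quaternion.imI_add, Quaternion.imJ_add, Quaternion.imK_add,
      hxre, hximI, hximJ, hximK, hX're, hX'imI, hX'imJ, hX'imK, hAre, hAimI, hAimJ, hAimK, hsAre, hsAimI, hsAimJ, hsAimK,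
      hA're, hA'imI, hA'imJ, hA'imK, hZre, hZimI, hZimJ, hZimK]
    ring
  have hgimI : g.imI = 2 * N⁻¹ ^ 2 * σ ^ 2 * ((u₁ ^ 2 + u₂ ^ 2) * (d.2.2.1 0 + 2 * δ / ‖a‖) - (u₂ * d.2.2.1 1 - u₁ * d.2.2.1 2)) := by
    rw [hg]
    simp only [Quaternion.imI_sub, Quaternion.re_add, Quaternion.re_mul, Quaternion.imI_mul, Quaternion.imJ_mul, Quaternion.imK_mul,
      Quaternion.imI_add, Quaternion.imJ_add, Quaternion.imK_add,
      hxre, hximI, hximJ, hximK, hX're, hX'imI, hX'imJ, hX'imK, hAre, hAimI, hAimJ, hAimK, hsAre, hsAimI, hsAimJ, hsAimK,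
      hA're, hA'imI, hA'imJ, hA'imK, hZre, hZimI, hZimJ, hZimK]
    ring
  have hgimJ : g.imJ = 2 * N⁻¹ ^ 2 * σ ^ 2 * (u₂ * (2 * d.1 + d.2.2.1 0 + (u₂ * d.2.2.1 1 - u₁ * d.2.2.1 2))) := by
    rw [hg]
    simp only [Quaternion.imJ_sub, Quaternion.re_add, Quaternion.re_mul, Quaternion.imI_mul, Quaternion.imJ_mul, Quaternion.imK_mul,
      Quaternion.imI_add, Quaternion.imJ_add, Quaternion.imK_add,
      hxre, hximI, hximJ, hximK, hX're, hX'imI, hX'imJ, hX'imK, hAre, hAimI, hAimJ, hAimK, hsAre, hsAimI, hsAimJ, hsAimK,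
      hA're, hA'imI, hA'imJ, hA'imK, hZre, hZimI, hZimJ, hZimK]
    ring
  have hgimK : g.imK = -(2 * N⁻¹ ^ 2 * σ ^ 2 * (u₁ * (2 * d.1 + d.2.2.1 0 + (u₂ * d.2.2.1 1 - u₁ * d.2.2.1 2)))) := by
    rw [hg]
    simp only [Quaternion.imK_sub, Quaternion.re_add, Quaternion.re_mul, Quaternion.imI_mul, Quaternion.imJ_mul, Quaternion.imK_mul,
      Quaternion.imI_add, Quaternion.imJ_add, Quaternion.imK_add,
      hxre, hximI, hximJ, hximK, hX're, hX'imI, hX'imJ, hX'imK, hAre, hAimI, hAimJ, hAimK, hsAre, hsAimI, hsAimJ, hsAimK,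
      hA're, hA'imI, hA'imJ, hA'imK, hZre, hZimI, hZimJ, hZimK]
    ring
  have hnorm : ‖g‖ ^ 2 = g.re ^ 2 + g.imI ^ 2 + g.imJ ^ 2 + g.imK ^ 2 := by
    rw [sq, ← Quaternion.normSq_eq_norm_mul_self, Quaternion.normSq_def']
  rw [hnorm, hgre, hgimI, hgimJ, hgimK]
  -- scalars
  have hσ2 : σ ^ 2 = 1 := by rw [hσ]; exact gnoSign_sq ε.1.1
  have hu1 : (0 : ℝ) < 1 + (u₁ ^ 2 + u₂ ^ 2) := by positivity
  have ht2 : N⁻¹ ^ 2 = (1 + (u₁ ^ 2 + u₂ ^ 2))⁻¹ := by rw [inv_pow, hN, Real.sq_sqrt hu1.le]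
  rw [hσ2, ht2]
  have hL6 : (L : ℝ) ^ 6 ≠ 0 := by positivity
  field_simp
  ring

end Summit.QuantumFields.YangMills.Theorems.SwapVirialDeficit.BlowUpRing

end
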